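import Summits.KontsevichZagierPeriods.KontsevichZagierPeriods.Theorems.HurwitzMicroSectorsNormalFormPrincipleM3Kernel
import Summits.KontsevichZagierPeriods.KontsevichZagierPeriods.Theorems.HurwitzMicroSectorsNormalFormPrincipleM3WordsLogCubeRef
import Summits.KontsevichZagierPeriods.KontsevichZagierPeriods.Theorems.HurwitzMicroSectorsNormalFormPrincipleM3WordsLogCube
import Summits.KontsevichZagierPeriods.KontsevichZagierPeriods.Theorems.HurwitzMicroSectorsNormalFormPrincipleM3WordsReduceWords1
import Summits.KontsevichZagierPeriods.KontsevichZagierPeriods.Theorems.HurwitzMicroSectorsNormalFormPrincipleM3WordsReduceWords2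
import Summits.KontsevichZagierPeriods.KontsevichZagierPeriods.Theorems.HurwitzMicroSectorsNormalFormPrincipleM3WordsReduceWords3
import Summits.KontsevichZagierPeriods.KontsevichZagierPeriods.Theorems.HurwitzMicroSectorsNormalFormPrincipleM3WordsReduceWords4

/-!
# `NormalFormPrinciple` (stmt-KontsevichZagierPeriods-3869), line `SketchIdeator1` — leaf `stub_boxRigidity`:
# the WORDS kernel capstone of the level-2 weight-3 descent (third period `(log 2)³`)

Assembly file (lead seat c9; `--supports` the crux). Extends `…M3Kernel.lean` (eleven box families,
basis `ζ(3)`, `ζ(2)log 2`) by the third period `(log 2)³`: generators = the eleven box families of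
the six `m3-equal-value-instances`, the LOG CUBE `[(0,1)³, 1/((1+x)(1+y)(1+z))]`, and the SIXTEEN
WORD representations `[Δ, x(t₀)y(t₁)z(t₂)]` of the descent (letters `a = 1/t, b = 1/(1−t),
c = 1/(1+t), d = 1/(2−t)`). **Conditionally on `LinearIndependent ℚ ![ζ(3), π²·log 2, (log 2)³]`,
Conjecture 1 holds on the subgroup of `KZ.FormalRep` they generate**
(`m3Words_mem_relations_of_eval_eq_zero`, registered corollary `m3_zetaThreeEighth_kernel`). Proof: every generator reduces with the
uniform multiplier `24` to `α[Z] + β[Q] + γ[B₃]` modulo relations (boxes: `m3k_reduce_*`; words: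
INTEGER CERTIFICATES over the relation packages, `m3x_reduce_words_1..4`, with the conversions
`[aab] = [Z]`, `[P, ab⊗c] = [Q]`, `[B₃] = 6[ccc]`); closure induction; evaluation
(`m3k_exists_refs`, `m3x_exists_logCubeRef`); independence; integer division by `24`
(`MzvKernelInKZ.Negative.mem_relations_of_nsmul_mem`). So the relation packages GENERATE every
`ℚ`-linear relation among the sixteen iterated integrals that the classical evaluations predict.
Sources: M. Kontsevich, D. Zagier, *Periods* (2001), §1.2 Conjecture 1; Borwein–Bradley–Broadhurst
(1997), §4. No definitions are introduced.
-/

noncomputable section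

open MeasureTheory Set
open Literature.NumberTheory.Transcendental Literature.NumberTheory.Transcendental.KZ
open Summit.KontsevichZagierPeriods.MzvKernelInKZ.Negative (mem_relations_of_nsmul_mem)

namespace Summit.KontsevichZagierPeriods.HurwitzMicroSectors.NormalFormPrinciple.PiBox.M3


/-- **Words kernel capstone (registered sub-goal `m3Words_mem_relations_of_eval_eq_zero` of
stmt-KontsevichZagierPeriods-3869, line `SketchIdeator1`).** Assume `ζ(3)`, `π²·log 2` and
`(log 2)³` are `ℚ`-linearly independent. Then every `ℤ`-combination of representations of the
eleven box families, the log cube and the sixteen word families of the level-2 weight-3 descent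
whose value vanishes is a relation of the Kontsevich–Zagier calculus.
[cite: KontsevichZagier2001, §1.2 Conjecture 1] -/
theorem m3Words_mem_relations_of_eval_eq_zero
    (hind : LinearIndependent ℚ ![zetaValue 3, Real.pi ^ 2 * Real.log 2, Real.log 2 ^ 3])
    {c : FormalRep}
    (hc : c ∈ AddSubgroup.closure
      ({y : FormalRep | ∃ N : IntegralRep 3, N.domain = {x | ∀ i, x i ∈ Set.Ioo (0:ℝ) 1} ∧
        EqOn N.integrand (fun x => 1 / ((1 - x 0 * x 1) * (1 - x 0 * x 1 * x 2))) N.domain ∧ y = of N} ∪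
      {y : FormalRep | ∃ N : IntegralRep 3, N.domain = {x | ∀ i, x i ∈ Set.Ioo (0:ℝ) 1} ∧
        EqOn N.integrand (fun x => 2 / (1 - x 0 * x 1 * x 2)) N.domain ∧ y = of N} ∪
      {y : FormalRep | ∃ N : IntegralRep 3, N.domain = {x | ∀ i, x i ∈ Set.Ioo (0:ℝ) 1} ∧
        EqOn N.integrand (fun x => 8 / ((1 + x 0 * x 1) * (1 + x 0 * x 1 * x 2))) N.domain ∧ y = of N} ∪
      {y : FormalRep | ∃ N : IntegralRep 3, N.domain = {x | ∀ i, x i ∈ Set.Ioo (0:ℝ) 1} ∧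
        EqOn N.integrand (fun x => 5 / (1 - x 0 * x 1 * x 2)) N.domain ∧ y = of N} ∪
      {y : FormalRep | ∃ N : IntegralRep 3, N.domain = {x | ∀ i, x i ∈ Set.Ioo (0:ℝ) 1} ∧
        EqOn N.integrand (fun x => 16 / ((2 - x 0) * (2 - x 0 * x 1 * x 2))) N.domain ∧ y = of N} ∪
      {y : FormalRep | ∃ N : IntegralRep 3, N.domain = {x | ∀ i, x i ∈ Set.Ioo (0:ℝ) 1} ∧
        EqOn N.integrand (fun x => 2 / ((2 - x 0 * x 1) * (2 - x 0 * x 1 * x 2))) N.domain ∧ y = of N} ∪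
      {y : FormalRep | ∃ N : IntegralRep 3, N.domain = {x | ∀ i, x i ∈ Set.Ioo (0:ℝ) 1} ∧
        EqOn N.integrand (fun x => 1 / ((1 + x 0) * (1 + x 0 * x 1 * x 2))) N.domain ∧ y = of N} ∪
      {y : FormalRep | ∃ N : IntegralRep 3, N.domain = {x | ∀ i, x i ∈ Set.Ioo (0:ℝ) 1} ∧
        EqOn N.integrand (fun x => 4 / ((2 - x 0) * (1 - x 0 * x 1 * x 2))) N.domain ∧ y = of N} ∪
      {y : FormalRep | ∃ N : IntegralRep 3, N.domain = {x | ∀ i, x i ∈ Set.Ioo (0:ℝ) 1} ∧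
        EqOn N.integrand (fun x => 3 / ((1 - x 0 * x 1) * (1 + x 2))) N.domain ∧ y = of N} ∪
      {y : FormalRep | ∃ N : IntegralRep 3, N.domain = {x | ∀ i, x i ∈ Set.Ioo (0:ℝ) 1} ∧
        EqOn N.integrand (fun x => 1 / (1 - x 0 * x 1 * x 2)) N.domain ∧ y = of N} ∪
      {y : FormalRep | ∃ N : IntegralRep 3, N.domain = {x | ∀ i, x i ∈ Set.Ioo (0:ℝ) 1} ∧
        EqOn N.integrand (fun x => 1 / ((1 - x 0 * x 1) * (1 + x 2))) N.domain ∧ y = of N} ∪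
      {y : FormalRep | ∃ N : IntegralRep 3, N.domain = {x | ∀ i, x i ∈ Set.Ioo (0:ℝ) 1} ∧
        EqOn N.integrand (fun x => 1 / ((1 + x 0) * (1 + x 1) * (1 + x 2))) N.domain ∧ y = of N} ∪
      {y : FormalRep | ∃ W : IntegralRep 3, W.domain = {t | 0 < t 2 ∧ t 2 < t 1 ∧ t 1 < t 0 ∧ t 0 < 1} ∧
        EqOn W.integrand (fun t => 1 / t 0 * 1 / t 1 * (1 / (1 - t 2))) W.domain ∧ y = of W} ∪
      {y : FormalRep | ∃ W : IntegralRep 3, W.domain = {t | 0 < t 2 ∧ t 2 < t 1 ∧ t 1 < t 0 ∧ t 0 < 1} ∧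
        EqOn W.integrand (fun t => 1 / t 0 * (1 / (1 - t 1)) * (1 / (1 - t 2))) W.domain ∧ y = of W} ∪
      {y : FormalRep | ∃ W : IntegralRep 3, W.domain = {t | 0 < t 2 ∧ t 2 < t 1 ∧ t 1 < t 0 ∧ t 0 < 1} ∧
        EqOn W.integrand (fun t => 1 / t 0 * 1 / t 1 * (1 / (1 + t 2))) W.domain ∧ y = of W} ∪
      {y : FormalRep | ∃ W : IntegralRep 3, W.domain = {t | 0 < t 2 ∧ t 2 < t 1 ∧ t 1 < t 0 ∧ t 0 < 1} ∧
        EqOn W.integrand (fun t => 1 / t 0 * (1 / (1 + t 1)) * (1 / (1 + t 2))) W.domain ∧ y = of W} ∪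
      {y : FormalRep | ∃ W : IntegralRep 3, W.domain = {t | 0 < t 2 ∧ t 2 < t 1 ∧ t 1 < t 0 ∧ t 0 < 1} ∧
        EqOn W.integrand (fun t => 1 / t 0 * (1 / (1 - t 1)) * (1 / (1 + t 2))) W.domain ∧ y = of W} ∪
      {y : FormalRep | ∃ W : IntegralRep 3, W.domain = {t | 0 < t 2 ∧ t 2 < t 1 ∧ t 1 < t 0 ∧ t 0 < 1} ∧
        EqOn W.integrand (fun t => 1 / t 0 * (1 / (1 + t 1)) * (1 / (1 - t 2))) W.domain ∧ y = of W} ∪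
      {y : FormalRep | ∃ W : IntegralRep 3, W.domain = {t | 0 < t 2 ∧ t 2 < t 1 ∧ t 1 < t 0 ∧ t 0 < 1} ∧
        EqOn W.integrand (fun t => 1 / (1 + t 0) * (1 / (1 - t 1)) * (1 / (1 - t 2))) W.domain ∧ y = of W} ∪
      {y : FormalRep | ∃ W : IntegralRep 3, W.domain = {t | 0 < t 2 ∧ t 2 < t 1 ∧ t 1 < t 0 ∧ t 0 < 1} ∧
        EqOn W.integrand (fun t => 1 / (1 + t 0) * (1 / (1 - t 1)) * (1 / (1 + t 2))) W.domain ∧ y = of W} ∪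
      {y : FormalRep | ∃ W : IntegralRep 3, W.domain = {t | 0 < t 2 ∧ t 2 < t 1 ∧ t 1 < t 0 ∧ t 0 < 1} ∧
        EqOn W.integrand (fun t => 1 / (1 + t 0) * (1 / (1 + t 1)) * (1 / (1 - t 2))) W.domain ∧ y = of W} ∪
      {y : FormalRep | ∃ W : IntegralRep 3, W.domain = {t | 0 < t 2 ∧ t 2 < t 1 ∧ t 1 < t 0 ∧ t 0 < 1} ∧
        EqOn W.integrand (fun t => 1 / (1 + t 0) * (1 / (1 + t 1)) * (1 / (1 + t 2))) W.domain ∧ y = of W} ∪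
      {y : FormalRep | ∃ W : IntegralRep 3, W.domain = {t | 0 < t 2 ∧ t 2 < t 1 ∧ t 1 < t 0 ∧ t 0 < 1} ∧
        EqOn W.integrand (fun t => 1 / (1 + t 0) * 1 / t 1 * (1 / (1 - t 2))) W.domain ∧ y = of W} ∪
      {y : FormalRep | ∃ W : IntegralRep 3, W.domain = {t | 0 < t 2 ∧ t 2 < t 1 ∧ t 1 < t 0 ∧ t 0 < 1} ∧
        EqOn W.integrand (fun t => 1 / (1 + t 0) * 1 / t 1 * (1 / (1 + t 2))) W.domain ∧ y = of W} ∪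
      {y : FormalRep | ∃ W : IntegralRep 3, W.domain = {t | 0 < t 2 ∧ t 2 < t 1 ∧ t 1 < t 0 ∧ t 0 < 1} ∧
        EqOn W.integrand (fun t => 1 / t 0 * 1 / t 1 * (1 / (2 - t 2))) W.domain ∧ y = of W} ∪
      {y : FormalRep | ∃ W : IntegralRep 3, W.domain = {t | 0 < t 2 ∧ t 2 < t 1 ∧ t 1 < t 0 ∧ t 0 < 1} ∧
        EqOn W.integrand (fun t => 1 / (2 - t 0) * 1 / t 1 * (1 / (2 - t 2))) W.domain ∧ y = of W} ∪
      {y : FormalRep | ∃ W : IntegralRep 3, W.domain = {t | 0 < t 2 ∧ t 2 < t 1 ∧ t 1 < t 0 ∧ t 0 < 1} ∧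
        EqOn W.integrand (fun t => 1 / t 0 * (1 / (2 - t 1)) * (1 / (2 - t 2))) W.domain ∧ y = of W} ∪
      {y : FormalRep | ∃ W : IntegralRep 3, W.domain = {t | 0 < t 2 ∧ t 2 < t 1 ∧ t 1 < t 0 ∧ t 0 < 1} ∧
        EqOn W.integrand (fun t => 1 / (2 - t 0) * 1 / t 1 * (1 / (1 - t 2))) W.domain ∧ y = of W}))
    (hv : eval c = 0) : c ∈ relations := by
  obtain ⟨Z, Q, N7, ⟨hZd, hZi, hZv⟩, ⟨hQd, hQi, hQv⟩, ⟨hN7d, hN7i⟩⟩ := m3k_exists_refs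
  obtain ⟨B3, hB3d, hB3i, hB3v⟩ := m3x_exists_logCubeRef
  obtain ⟨r10, r2, r4, r1, r3, r5⟩ := m3k_reduce_zeta Z Q N7 hZd hZi hQd hQi hN7d hN7i
  obtain ⟨r11, r9, r8, r7, r6⟩ := m3k_reduce_log Z Q N7 hZd hZi hQd hQi hN7d hN7i
  obtain ⟨w1, w2, w3, w4⟩ := m3x_reduce_words_1 Z Q B3 hZd hZi hQd hQi hB3d hB3i
  obtain ⟨w5, w6, w7, w8⟩ := m3x_reduce_words_2 Z Q B3 hZd hZi hQd hQi hB3d hB3i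
  obtain ⟨w9, w10, w11, w12⟩ := m3x_reduce_words_3 Z Q B3 hZd hZi hQd hQi hB3d hB3i
  obtain ⟨w13, w14, w15, w16⟩ := m3x_reduce_words_4 Z Q B3 hZd hZi hQd hQi hB3d hB3i
  -- a box reduction with multiplier 2 gives one with multiplier 24
  have lift : ∀ (y : FormalRep) (α β : ℤ), (2:ℕ) • y - (α • of Z + β • of Q) ∈ relations →
      (24:ℕ) • y - ((12 * α) • of Z + (12 * β) • of Q + (0:ℤ) • of B3) ∈ relations := by
    intro y α β h
    have e : (24:ℕ) • y - ((12 * α) • of Z + (12 * β) • of Q + (0:ℤ) • of B3) =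
        (12:ℕ) • ((2:ℕ) • y - (α • of Z + β • of Q)) := by
      rw [zero_smul, add_zero, smul_sub, smul_add, ← mul_nsmul', ← natCast_zsmul (α • of Z) 12,
        ← natCast_zsmul (β • of Q) 12, smul_smul, smul_smul]
      norm_num
    rw [e]
    exact relations.nsmul_mem h 12
  -- the log cube itself
  have rB3 : ∀ N : IntegralRep 3, N.domain = {x | ∀ i, x i ∈ Set.Ioo (0:ℝ) 1} →
      EqOn N.integrand (fun x => 1 / ((1 + x 0) * (1 + x 1) * (1 + x 2))) N.domain →
      (24:ℕ) • of N - ((0:ℤ) • of Z + (0:ℤ) • of Q + (24:ℤ) • of B3) ∈ relations := by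
    intro N hNd hNi
    have h : of N - of B3 ∈ relations :=
      of_sub_of_mem_relations_of_eqOn (hB3d.trans hNd.symm) fun x hx => by
        rw [hNi hx, hB3i]
    have e : (24:ℕ) • of N - ((0:ℤ) • of Z + (0:ℤ) • of Q + (24:ℤ) • of B3) = (24:ℕ) • (of N - of B3) := by
      simp only [zero_smul, zero_add, smul_sub]
      norm_cast
    rw [e]
    exact relations.nsmul_mem h 24
  have hred : ∀ c ∈ AddSubgroup.closure
      ({y : FormalRep | ∃ N : IntegralRep 3, N.domain = {x | ∀ i, x i ∈ Set.Ioo (0:ℝ) 1} ∧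
        EqOn N.integrand (fun x => 1 / ((1 - x 0 * x 1) * (1 - x 0 * x 1 * x 2))) N.domain ∧ y = of N} ∪
      {y : FormalRep | ∃ N : IntegralRep 3, N.domain = {x | ∀ i, x i ∈ Set.Ioo (0:ℝ) 1} ∧
        EqOn N.integrand (fun x => 2 / (1 - x 0 * x 1 * x 2)) N.domain ∧ y = of N} ∪
      {y : FormalRep | ∃ N : IntegralRep 3, N.domain = {x | ∀ i, x i ∈ Set.Ioo (0:ℝ) 1} ∧
        EqOn N.integrand (fun x => 8 / ((1 + x 0 * x 1) * (1 + x 0 * x 1 * x 2))) N.domain ∧ y = of N} ∪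
      {y : FormalRep | ∃ N : IntegralRep 3, N.domain = {x | ∀ i, x i ∈ Set.Ioo (0:ℝ) 1} ∧
        EqOn N.integrand (fun x => 5 / (1 - x 0 * x 1 * x 2)) N.domain ∧ y = of N} ∪
      {y : FormalRep | ∃ N : IntegralRep 3, N.domain = {x | ∀ i, x i ∈ Set.Ioo (0:ℝ) 1} ∧
        EqOn N.integrand (fun x => 16 / ((2 - x 0) * (2 - x 0 * x 1 * x 2))) N.domain ∧ y = of N} ∪
      {y : FormalRep | ∃ N : IntegralRep 3, N.domain = {x | ∀ i, x i ∈ Set.Ioo (0:ℝ) 1} ∧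
        EqOn N.integrand (fun x => 2 / ((2 - x 0 * x 1) * (2 - x 0 * x 1 * x 2))) N.domain ∧ y = of N} ∪
      {y : FormalRep | ∃ N : IntegralRep 3, N.domain = {x | ∀ i, x i ∈ Set.Ioo (0:ℝ) 1} ∧
        EqOn N.integrand (fun x => 1 / ((1 + x 0) * (1 + x 0 * x 1 * x 2))) N.domain ∧ y = of N} ∪
      {y : FormalRep | ∃ N : IntegralRep 3, N.domain = {x | ∀ i, x i ∈ Set.Ioo (0:ℝ) 1} ∧
        EqOn N.integrand (fun x => 4 / ((2 - x 0) * (1 - x 0 * x 1 * x 2))) N.domain ∧ y = of N} ∪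
      {y : FormalRep | ∃ N : IntegralRep 3, N.domain = {x | ∀ i, x i ∈ Set.Ioo (0:ℝ) 1} ∧
        EqOn N.integrand (fun x => 3 / ((1 - x 0 * x 1) * (1 + x 2))) N.domain ∧ y = of N} ∪
      {y : FormalRep | ∃ N : IntegralRep 3, N.domain = {x | ∀ i, x i ∈ Set.Ioo (0:ℝ) 1} ∧
        EqOn N.integrand (fun x => 1 / (1 - x 0 * x 1 * x 2)) N.domain ∧ y = of N} ∪
      {y : FormalRep | ∃ N : IntegralRep 3, N.domain = {x | ∀ i, x i ∈ Set.Ioo (0:ℝ) 1} ∧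
        EqOn N.integrand (fun x => 1 / ((1 - x 0 * x 1) * (1 + x 2))) N.domain ∧ y = of N} ∪
      {y : FormalRep | ∃ N : IntegralRep 3, N.domain = {x | ∀ i, x i ∈ Set.Ioo (0:ℝ) 1} ∧
        EqOn N.integrand (fun x => 1 / ((1 + x 0) * (1 + x 1) * (1 + x 2))) N.domain ∧ y = of N} ∪
      {y : FormalRep | ∃ W : IntegralRep 3, W.domain = {t | 0 < t 2 ∧ t 2 < t 1 ∧ t 1 < t 0 ∧ t 0 < 1} ∧
        EqOn W.integrand (fun t => 1 / t 0 * 1 / t 1 * (1 / (1 - t 2))) W.domain ∧ y = of W} ∪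
      {y : FormalRep | ∃ W : IntegralRep 3, W.domain = {t | 0 < t 2 ∧ t 2 < t 1 ∧ t 1 < t 0 ∧ t 0 < 1} ∧
        EqOn W.integrand (fun t => 1 / t 0 * (1 / (1 - t 1)) * (1 / (1 - t 2))) W.domain ∧ y = of W} ∪
      {y : FormalRep | ∃ W : IntegralRep 3, W.domain = {t | 0 < t 2 ∧ t 2 < t 1 ∧ t 1 < t 0 ∧ t 0 < 1} ∧
        EqOn W.integrand (fun t => 1 / t 0 * 1 / t 1 * (1 / (1 + t 2))) W.domain ∧ y = of W} ∪
      {y : FormalRep | ∃ W : IntegralRep 3, W.domain = {t | 0 < t 2 ∧ t 2 < t 1 ∧ t 1 < t 0 ∧ t 0 < 1} ∧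
        EqOn W.integrand (fun t => 1 / t 0 * (1 / (1 + t 1)) * (1 / (1 + t 2))) W.domain ∧ y = of W} ∪
      {y : FormalRep | ∃ W : IntegralRep 3, W.domain = {t | 0 < t 2 ∧ t 2 < t 1 ∧ t 1 < t 0 ∧ t 0 < 1} ∧
        EqOn W.integrand (fun t => 1 / t 0 * (1 / (1 - t 1)) * (1 / (1 + t 2))) W.domain ∧ y = of W} ∪
      {y : FormalRep | ∃ W : IntegralRep 3, W.domain = {t | 0 < t 2 ∧ t 2 < t 1 ∧ t 1 < t 0 ∧ t 0 < 1} ∧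
        EqOn W.integrand (fun t => 1 / t 0 * (1 / (1 + t 1)) * (1 / (1 - t 2))) W.domain ∧ y = of W} ∪
      {y : FormalRep | ∃ W : IntegralRep 3, W.domain = {t | 0 < t 2 ∧ t 2 < t 1 ∧ t 1 < t 0 ∧ t 0 < 1} ∧
        EqOn W.integrand (fun t => 1 / (1 + t 0) * (1 / (1 - t 1)) * (1 / (1 - t 2))) W.domain ∧ y = of W} ∪
      {y : FormalRep | ∃ W : IntegralRep 3, W.domain = {t | 0 < t 2 ∧ t 2 < t 1 ∧ t 1 < t 0 ∧ t 0 < 1} ∧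
        EqOn W.integrand (fun t => 1 / (1 + t 0) * (1 / (1 - t 1)) * (1 / (1 + t 2))) W.domain ∧ y = of W} ∪
      {y : FormalRep | ∃ W : IntegralRep 3, W.domain = {t | 0 < t 2 ∧ t 2 < t 1 ∧ t 1 < t 0 ∧ t 0 < 1} ∧
        EqOn W.integrand (fun t => 1 / (1 + t 0) * (1 / (1 + t 1)) * (1 / (1 - t 2))) W.domain ∧ y = of W} ∪
      {y : FormalRep | ∃ W : IntegralRep 3, W.domain = {t | 0 < t 2 ∧ t 2 < t 1 ∧ t 1 < t 0 ∧ t 0 < 1} ∧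
        EqOn W.integrand (fun t => 1 / (1 + t 0) * (1 / (1 + t 1)) * (1 / (1 + t 2))) W.domain ∧ y = of W} ∪
      {y : FormalRep | ∃ W : IntegralRep 3, W.domain = {t | 0 < t 2 ∧ t 2 < t 1 ∧ t 1 < t 0 ∧ t 0 < 1} ∧
        EqOn W.integrand (fun t => 1 / (1 + t 0) * 1 / t 1 * (1 / (1 - t 2))) W.domain ∧ y = of W} ∪
      {y : FormalRep | ∃ W : IntegralRep 3, W.domain = {t | 0 < t 2 ∧ t 2 < t 1 ∧ t 1 < t 0 ∧ t 0 < 1} ∧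
        EqOn W.integrand (fun t => 1 / (1 + t 0) * 1 / t 1 * (1 / (1 + t 2))) W.domain ∧ y = of W} ∪
      {y : FormalRep | ∃ W : IntegralRep 3, W.domain = {t | 0 < t 2 ∧ t 2 < t 1 ∧ t 1 < t 0 ∧ t 0 < 1} ∧
        EqOn W.integrand (fun t => 1 / t 0 * 1 / t 1 * (1 / (2 - t 2))) W.domain ∧ y = of W} ∪
      {y : FormalRep | ∃ W : IntegralRep 3, W.domain = {t | 0 < t 2 ∧ t 2 < t 1 ∧ t 1 < t 0 ∧ t 0 < 1} ∧
        EqOn W.integrand (fun t => 1 / (2 - t 0) * 1 / t 1 * (1 / (2 - t 2))) W.domain ∧ y = of W} ∪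
      {y : FormalRep | ∃ W : IntegralRep 3, W.domain = {t | 0 < t 2 ∧ t 2 < t 1 ∧ t 1 < t 0 ∧ t 0 < 1} ∧
        EqOn W.integrand (fun t => 1 / t 0 * (1 / (2 - t 1)) * (1 / (2 - t 2))) W.domain ∧ y = of W} ∪
      {y : FormalRep | ∃ W : IntegralRep 3, W.domain = {t | 0 < t 2 ∧ t 2 < t 1 ∧ t 1 < t 0 ∧ t 0 < 1} ∧
        EqOn W.integrand (fun t => 1 / (2 - t 0) * 1 / t 1 * (1 / (1 - t 2))) W.domain ∧ y = of W}), ∃ α β γ : ℤ, (24:ℕ) • c - (α • of Z + β • of Q + γ • of B3) ∈ relations := by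
    intro c hc
    induction hc using AddSubgroup.closure_induction with
    | mem y hy =>
      simp only [mem_union, mem_setOf_eq] at hy
      rcases hy with (((((((((((((((((((((((((((⟨N, hNd, hNi, rfl⟩ | ⟨N, hNd, hNi, rfl⟩) |
        ⟨N, hNd, hNi, rfl⟩) | ⟨N, hNd, hNi, rfl⟩) | ⟨N, hNd, hNi, rfl⟩) | ⟨N, hNd, hNi, rfl⟩) |
        ⟨N, hNd, hNi, rfl⟩) | ⟨N, hNd, hNi, rfl⟩) | ⟨N, hNd, hNi, rfl⟩) | ⟨N, hNd, hNi, rfl⟩) |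
        ⟨N, hNd, hNi, rfl⟩) | ⟨N, hNd, hNi, rfl⟩) | ⟨N, hNd, hNi, rfl⟩) | ⟨N, hNd, hNi, rfl⟩) |
        ⟨N, hNd, hNi, rfl⟩) | ⟨N, hNd, hNi, rfl⟩) | ⟨N, hNd, hNi, rfl⟩) | ⟨N, hNd, hNi, rfl⟩) |
        ⟨N, hNd, hNi, rfl⟩) | ⟨N, hNd, hNi, rfl⟩) | ⟨N, hNd, hNi, rfl⟩) | ⟨N, hNd, hNi, rfl⟩) |
        ⟨N, hNd, hNi, rfl⟩) | ⟨N, hNd, hNi, rfl⟩) | ⟨N, hNd, hNi, rfl⟩) | ⟨N, hNd, hNi, rfl⟩) |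
        ⟨N, hNd, hNi, rfl⟩) | ⟨N, hNd, hNi, rfl⟩)
      · exact ⟨_, _, _, lift _ _ _ (r1 N hNd hNi)⟩
      · exact ⟨_, _, _, lift _ _ _ (r2 N hNd hNi)⟩
      · exact ⟨_, _, _, lift _ _ _ (r3 N hNd hNi)⟩
      · exact ⟨_, _, _, lift _ _ _ (r4 N hNd hNi)⟩
      · exact ⟨_, _, _, lift _ _ _ (r5 N hNd hNi)⟩
      · exact ⟨_, _, _, lift _ _ _ (r6 N hNd hNi)⟩
      · exact ⟨_, _, _, lift _ _ _ (r7 N hNd hNi)⟩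
      · exact ⟨_, _, _, lift _ _ _ (r8 N hNd hNi)⟩
      · exact ⟨_, _, _, lift _ _ _ (r9 N hNd hNi)⟩
      · exact ⟨_, _, _, lift _ _ _ (r10 N hNd hNi)⟩
      · exact ⟨_, _, _, lift _ _ _ (r11 N hNd hNi)⟩
      · exact ⟨_, _, _, rB3 N hNd hNi⟩
      · exact ⟨_, _, _, w1 N hNd hNi⟩
      · exact ⟨_, _, _, w2 N hNd hNi⟩
      · exact ⟨_, _, _, w3 N hNd hNi⟩
      · exact ⟨_, _, _, w4 N hNd hNi⟩
      · exact ⟨_, _, _, w5 N hNd hNi⟩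
      · exact ⟨_, _, _, w6 N hNd hNi⟩
      · exact ⟨_, _, _, w7 N hNd hNi⟩
      · exact ⟨_, _, _, w8 N hNd hNi⟩
      · exact ⟨_, _, _, w9 N hNd hNi⟩
      · exact ⟨_, _, _, w10 N hNd hNi⟩
      · exact ⟨_, _, _, w11 N hNd hNi⟩
      · exact ⟨_, _, _, w12 N hNd hNi⟩
      · exact ⟨_, _, _, w13 N hNd hNi⟩
      · exact ⟨_, _, _, w14 N hNd hNi⟩
      · exact ⟨_, _, _, w15 N hNd hNi⟩
      · exact ⟨_, _, _, w16 N hNd hNi⟩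
    | zero =>
      refine ⟨0, 0, 0, ?_⟩
      simp only [smul_zero, zero_smul, add_zero, sub_zero]
      exact relations.zero_mem
    | add y z _ _ ihy ihz =>
      obtain ⟨α₁, β₁, γ₁, h₁⟩ := ihy
      obtain ⟨α₂, β₂, γ₂, h₂⟩ := ihz
      refine ⟨α₁ + α₂, β₁ + β₂, γ₁ + γ₂, ?_⟩
      have e : (24:ℕ) • (y + z) - ((α₁ + α₂) • of Z + (β₁ + β₂) • of Q + (γ₁ + γ₂) • of B3) =
          ((24:ℕ) • y - (α₁ • of Z + β₁ • of Q + γ₁ • of B3)) +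
          ((24:ℕ) • z - (α₂ • of Z + β₂ • of Q + γ₂ • of B3)) := by
        simp only [smul_add, add_smul]; abel
      rw [e]
      exact relations.add_mem h₁ h₂
    | neg y _ ih =>
      obtain ⟨α, β, γ, h⟩ := ih
      refine ⟨-α, -β, -γ, ?_⟩
      have e : (24:ℕ) • (-y) - ((-α) • of Z + (-β) • of Q + (-γ) • of B3) =
          -((24:ℕ) • y - (α • of Z + β • of Q + γ • of B3)) := by
        simp only [smul_neg, neg_smul]; abel
      rw [e]
      exact relations.neg_mem h
  obtain ⟨α, β, γ, h⟩ := hred c hc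
  have hev := relations_le_ker_eval_holds h
  rw [AddMonoidHom.mem_ker, map_sub, map_nsmul, map_add, map_add, map_zsmul, map_zsmul, map_zsmul,
    eval_of, eval_of, eval_of, hv, hZv, hQv, hB3v, smul_zero, zero_sub, neg_eq_zero] at hev
  have hαβγ : α = 0 ∧ β = 0 ∧ γ = 0 := by
    rw [Fintype.linearIndependent_iff] at hind
    have key := hind ![(α : ℚ), (β : ℚ) / 6, (γ : ℚ)] (by
      rw [Fin.sum_univ_three]
      simp only [Matrix.cons_val_zero, Matrix.cons_val_one, Matrix.cons_val_two, Matrix.head_cons,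
        Matrix.tail_cons, Rat.smul_def]
      push_cast
      rw [zsmul_eq_mul, zsmul_eq_mul, zsmul_eq_mul] at hev
      linarith)
    have h0 := key 0
    have h1 := key 1
    have h2 := key 2
    simp only [Matrix.cons_val_zero, Matrix.cons_val_one, Matrix.cons_val_two, Matrix.head_cons,
      Matrix.tail_cons] at h0 h1 h2
    exact ⟨by exact_mod_cast h0, by
      have : (β : ℚ) = 0 := by linarith
      exact_mod_cast this, by exact_mod_cast h2⟩
  obtain ⟨rfl, rfl, rfl⟩ := hαβγ
  simp only [zero_smul, add_zero, sub_zero] at h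
  exact mem_relations_of_nsmul_mem (by norm_num) h

/-- **The `ζ(3)/8` cluster (registered sub-goal `m3_zetaThreeEighth_kernel` of
stmt-KontsevichZagierPeriods-3869, line `SketchIdeator1`).** Conjecture 1, conditionally on
`LinearIndependent ℚ ![ζ(3), π²·log 2, (log 2)³]`, on the subgroup generated by the `ζ(3)` box
`[(0,1)³, 1/(1−xyz)]`, the log cube `[(0,1)³, 1/((1+x)(1+y)(1+z))]` and the three word
representations `[Δ, acc]` (value `ζ(3)/8`), `[Δ, ccb]` (value `ζ(3)/8 − (log 2)³/6`) and `[Δ, ccc]`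
(value `(log 2)³/6`) — a corollary of the words kernel capstone singled out because it mixes the two
periods `ζ(3)` and `(log 2)³` with the evaluation `∫acc = ζ(3)/8` proved inside the calculus.
[cite: KontsevichZagier2001, §1.2 Conjecture 1] -/
theorem m3_zetaThreeEighth_kernel
    (hind : LinearIndependent ℚ ![zetaValue 3, Real.pi ^ 2 * Real.log 2, Real.log 2 ^ 3])
    {c : FormalRep}
    (hc : c ∈ AddSubgroup.closure
      ({y : FormalRep | ∃ N : IntegralRep 3, N.domain = {x | ∀ i, x i ∈ Set.Ioo (0:ℝ) 1} ∧
        EqOn N.integrand (fun x => 1 / (1 - x 0 * x 1 * x 2)) N.domain ∧ y = of N} ∪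
      {y : FormalRep | ∃ N : IntegralRep 3, N.domain = {x | ∀ i, x i ∈ Set.Ioo (0:ℝ) 1} ∧
        EqOn N.integrand (fun x => 1 / ((1 + x 0) * (1 + x 1) * (1 + x 2))) N.domain ∧ y = of N} ∪
      {y : FormalRep | ∃ W : IntegralRep 3, W.domain = {t | 0 < t 2 ∧ t 2 < t 1 ∧ t 1 < t 0 ∧ t 0 < 1} ∧
        EqOn W.integrand (fun t => 1 / t 0 * (1 / (1 + t 1)) * (1 / (1 + t 2))) W.domain ∧ y = of W} ∪
      {y : FormalRep | ∃ W : IntegralRep 3, W.domain = {t | 0 < t 2 ∧ t 2 < t 1 ∧ t 1 < t 0 ∧ t 0 < 1} ∧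
        EqOn W.integrand (fun t => 1 / (1 + t 0) * (1 / (1 + t 1)) * (1 / (1 - t 2))) W.domain ∧ y = of W} ∪
      {y : FormalRep | ∃ W : IntegralRep 3, W.domain = {t | 0 < t 2 ∧ t 2 < t 1 ∧ t 1 < t 0 ∧ t 0 < 1} ∧
        EqOn W.integrand (fun t => 1 / (1 + t 0) * (1 / (1 + t 1)) * (1 / (1 + t 2))) W.domain ∧ y = of W}))
    (hv : eval c = 0) : c ∈ relations := by
  refine m3Words_mem_relations_of_eval_eq_zero hind (AddSubgroup.closure_mono ?_ hc) hv
  intro y hy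
  simp only [mem_union] at hy ⊢
  tauto

end Summit.KontsevichZagierPeriods.HurwitzMicroSectors.NormalFormPrinciple.PiBox.M3
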